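import Mathlib
import HarnessLib
import Summits.HubbardSuperconductivity.HubbardSuperconductivity.Theorems.KLProgrammePerturbedFermiCurveCompDiffGraded2
import Summits.HubbardSuperconductivity.HubbardSuperconductivity.Theorems.KLProgrammePerturbedFermiCurveExplicit
import Summits.HubbardSuperconductivity.HubbardSuperconductivity.Theorems.KLProgrammeKLRegimeSplitTwoLegReadJetsStruct
import Summits.HubbardSuperconductivity.HubbardSuperconductivity.Theorems.KLProgrammeKLRegimeSplitPredicatesV5
import Summits.HubbardSuperconductivity.HubbardSuperconductivity.Theorems.KLProgrammeKLRegimeFlowReadResidueSplit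

/-!
# Route `KLProgramme`, crux K3 — engine-flow child (stmt-HubbardSuperconductivity-20437 `KLRegimeEngineV17F2`), stub (C) `stub_twoLeg_curvature`:
# the (C2) TRANSPORT DOOR — jets of a `C⁵` symbol between the two Fermi curves of an admissible frame pair `K₀`, `K₀ ⊖ p`

Cell gate-hubbard-kl, seat hubbard-kl-k3c3-p3 (g6; row «implicit-function / monotonicity route for μ(n)»).  The residue split
`…FlowReadResidueSplit` (p533029) asks three doors for the k ≤ 4 jets of (B), (C2), (C1); this file is (C2):
  `θ ↦ F(k_F^{K₀ ⊖ p}(θ)) − F(k_F^{K₀}(θ))`   for a `C⁵` symbol `F` with global nested sizes `M₁ … M₅`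
(for the flow: `F = evalM ν̃_n`, `ν̃_n = symInterp L (klLocSelfEnergyRe … K_n n)`, whose second term IS `ν_n(K_n)(θ)`), from
* both frames admissible at depth `n ≤ nScales β`: `FrameOK R U n μ K₀`, `FrameOK R U n μ (K₀ ⊖ p)` in the curve regime `c ≤ klCurveC3 R`,
  `U ≤ klCurveU0 R` (orders ≤ 2 + thresholds: `FrameOK.mono` + `frame_sizes_of_frameOK_explicit` (p485512); orders 3, 4 SHARP at depth `n`:
  `frameShift_high_sizes_of_frameOK` (p526546): `A₃ = Gfr₃U²4^{n+1}/3`, `A₄ = Gfr₄U²16^{n+1}/15`);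
* the piece's jets `‖Dʲ evalM p‖ ≤ Gfr_j·uPow j U·4^{(j−2)n}` (the `FlowPieceJetsAt` currency; `frameShift (0 ⊖ p) = evalM p`);
* graded parameters `η₀ ≥ Gfr₀|U|16^{−n}`, `η·lʲ ≥ Gfr_j U² 4^{(j−2)n}` (`1 ≤ j ≤ 4`), `l ≥ max(1, A₃, √A₄)` — supplied canonically by
  `flow_graded_params` (`η := (Gfr₁+…+Gfr₄)U²16^{−n}`, `l := 4ⁿ(1 + 2(Gfr₃+Gfr₄)U²)`),
through the composite-difference theorems of `…PerturbedFermiCurveCompDiffGraded2` (p502510): **`transport_jets_of_frameOK`** (orders 0–4 at once, explicit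
closed constants at `(e, e₀, λ) := (η, η₀, 2l)`).  Every term carries `η₀ ∝ |U|`, `η ∝ U²` times `M_j`, or `M₁·A₄` — `|U|`-suppressed against the `U²`
bars as soon as `M₁ = O(|U|)`; the fit to `curveJetBar` tables is the registrant's arithmetic.
Proofs only; nothing about the model's sizes is asserted.  BGM 2006 §2.4 Lemma 2.1 (2.40) [cite: BenfattoGiulianiMastropietro2006].
-/

noncomputable section

namespace Summit.HubbardSuperconductivity.HubbardSuperconductivity.Theorems.PerturbedFermiCurve

set_option linter.dupNamespace false -- summit = problem name (single-conjunct summit), D-0017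
set_option maxSynthPendingDepth 4 -- nested operator-norm instances (up to fifth Fréchet derivatives)

open Real Set
open Literature.MathematicalPhysics.QuantumLattice Literature.MathematicalPhysics.QuantumLattice.BandSectorCounting
open Summit.HubbardSuperconductivity.HubbardSuperconductivity.Theorems.DispersionFlow
open Summit.HubbardSuperconductivity.HubbardSuperconductivity.Theorems.KLRegimeSplit

/-! ## §1 The increment `0 ⊖ p` and its frame shift -/

/-- `(0 ⊖ p)(q) = (K₀ ⊖ p)(q) − K₀(q)`. -/
theorem eval_fsub_zero_eq_sub (K₀ p : TrigPolyC4v) (q : Fin 2 → ℝ) : (fsub 0 p).eval q = (fsub K₀ p).eval q - K₀.eval q := by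
  rw [eval_fsub, eval_fsub, TrigPolyC4v.eval_zero]; ring

/-- `frameShift (0 ⊖ p) = evalM p`. -/
theorem frameShift_fsub_zero (p : TrigPolyC4v) : frameShift (fsub 0 p) = evalM p := by
  funext q; simp [frameShift, evalM, eval_fsub, TrigPolyC4v.eval_zero]

/-! ## §2 The transport door for a generic admissible pair -/

section Pair

variable {R : RenConsts} (hR : ∀ j, 0 ≤ R.Gfr j) {c U β μ : ℝ} (hc : 0 < c) (hcle : c ≤ klCurveC3 R) (hU : 0 < U) (hUle : U ≤ klCurveU0 R)
  (hβmin : klBetaMin ≤ β) (hβc : β ≤ Real.exp (c / U ^ 2)) (hμ : μ ∈ klWindowC)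
  {K₀ p : TrigPolyC4v} {n : ℕ} (hn : n ≤ nScales β) (hK₀ : FrameOK R U n μ K₀) (hK : FrameOK R U n μ (fsub K₀ p))
  (hp : ∀ j ≤ 4, ∀ q : Momentum, ‖iteratedFDeriv ℝ j (evalM p) q‖ ≤ R.Gfr j * uPow j U * (4 : ℝ) ^ (((j : ℤ) - 2) * n))
  {η η₀ l : ℝ} (hη : 0 ≤ η) (hη₀ : 0 ≤ η₀) (hl : 1 ≤ l)
  (hA₃l : R.Gfr 3 * U ^ 2 * ((4 : ℝ) ^ (n + 1) / 3) ≤ l) (hA₄l : R.Gfr 4 * U ^ 2 * ((16 : ℝ) ^ (n + 1) / 15) ≤ l ^ 2)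
  (hh0 : R.Gfr 0 * uPow 0 U * (4 : ℝ) ^ ((((0 : ℕ) : ℤ) - 2) * n) ≤ η₀)
  (hhη : ∀ j : ℕ, 1 ≤ j → j ≤ 4 → R.Gfr j * uPow j U * (4 : ℝ) ^ (((j : ℤ) - 2) * n) ≤ η * l ^ j)
  {F : Momentum → ℝ} (hF : ContDiff ℝ 5 F) {M₁ M₂ M₃ M₄ M₅ : ℝ}
  (hM₁ : ∀ z, ‖fderiv ℝ F z‖ ≤ M₁) (hM₂ : ∀ z, ‖fderiv ℝ (fderiv ℝ F) z‖ ≤ M₂)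
  (hM₃ : ∀ z, ‖fderiv ℝ (fderiv ℝ (fderiv ℝ F)) z‖ ≤ M₃) (hM₄ : ∀ z, ‖fderiv ℝ (fderiv ℝ (fderiv ℝ (fderiv ℝ F))) z‖ ≤ M₄)
  (hM₅ : ∀ z, ‖fderiv ℝ (fderiv ℝ (fderiv ℝ (fderiv ℝ (fderiv ℝ F)))) z‖ ≤ M₅)
include hR hc hcle hU hUle hβmin hβc hμ hn hK₀ hK hp hη hη₀ hl hA₃l hA₄l hh0 hhη hF hM₁ hM₂ hM₃ hM₄ hM₅

/-- **THE (C2) TRANSPORT DOOR, orders 0–4**, for an admissible pair `K₀`, `K₀ ⊖ p` at depth `n` in the curve regime: the graded composite-difference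
bounds of `…CompDiffGraded2` at `(e, e₀, λ) := (η, η₀, 2l)`, `A₄ := Gfr₄U²16^{n+1}/15`. -/
theorem transport_jets_of_frameOK (θ : ℝ) :
    |F (WithLp.toLp 2 (klFermiPoint μ (fsub K₀ p) θ)) - F (WithLp.toLp 2 (klFermiPoint μ K₀ θ))| ≤ 12.2 * M₁ * η₀ ∧
    |iteratedDeriv 1 (F ∘ fun θ : ℝ => (WithLp.toLp 2 (klFermiPoint μ (fsub K₀ p) θ) : Momentum)) θ -
        iteratedDeriv 1 (F ∘ fun θ : ℝ => (WithLp.toLp 2 (klFermiPoint μ K₀ θ) : Momentum)) θ| ≤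
      η * (1420 * M₁ * (2 * l)) + η₀ * (36400 * M₁ + 2820 * M₂) ∧
    |iteratedDeriv 2 (F ∘ fun θ : ℝ => (WithLp.toLp 2 (klFermiPoint μ (fsub K₀ p) θ) : Momentum)) θ -
        iteratedDeriv 2 (F ∘ fun θ : ℝ => (WithLp.toLp 2 (klFermiPoint μ K₀ θ) : Momentum)) θ| ≤
      η * (12900000 * M₁ * (2 * l) ^ 2 + 657000 * M₂ * (2 * l)) + η₀ * (338000000 * M₁ * (2 * l) + 25400000 * M₂ + 652000 * M₃) ∧
    |iteratedDeriv 3 (F ∘ fun θ : ℝ => (WithLp.toLp 2 (klFermiPoint μ (fsub K₀ p) θ) : Momentum)) θ -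
        iteratedDeriv 3 (F ∘ fun θ : ℝ => (WithLp.toLp 2 (klFermiPoint μ K₀ θ) : Momentum)) θ| ≤
      η * (199000000000 * M₁ * (2 * l) ^ 3 + 12000000000 * M₂ * (2 * l) ^ 2 + 228000000 * M₃ * (2 * l)) +
        η₀ * (5230000000000 * M₁ * (2 * l) ^ 2 + 392000000000 * M₂ * (2 * l) + 11800000000 * M₃ + 151000000 * M₄) ∧
    |iteratedDeriv 4 (F ∘ fun θ : ℝ => (WithLp.toLp 2 (klFermiPoint μ (fsub K₀ p) θ) : Momentum)) θ -
        iteratedDeriv 4 (F ∘ fun θ : ℝ => (WithLp.toLp 2 (klFermiPoint μ K₀ θ) : Momentum)) θ| ≤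
      η * (4300000000000000 * M₁ * (2 * l) ^ 4 + 276000000000000 * M₂ * (2 * l) ^ 3 + 6890000000000 * M₃ * (2 * l) ^ 2 +
          70100000000 * M₄ * (2 * l)) +
        η₀ * (114000000000000000 * M₁ * (2 * l) ^ 2 + 8490000000000000 * M₂ * (2 * l) ^ 2 + 272000000000000 * M₃ * (2 * l) +
          4530000000000 * M₄ + 34800000000 * M₅) + 69200000000 * M₁ * (R.Gfr 4 * U ^ 2 * ((16 : ℝ) ^ (n + 1) / 15)) := by
  -- frame data: orders ≤ 2 and thresholds at depth `nScales β` (mono), orders 3, 4 at depth `n`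
  obtain ⟨hA, hA20, -, hd, ⟨hlo, hhi⟩, -, -⟩ := frame_sizes_of_frameOK_explicit hR hc hcle hU hUle hβmin hβc hμ (FrameOK.mono hR hn hK₀)
  obtain ⟨hA', -, -, -, -, -, -⟩ := frame_sizes_of_frameOK_explicit hR hc hcle hU hUle hβmin hβc hμ (FrameOK.mono hR hn hK)
  obtain ⟨hA₃, hA₄⟩ := frameShift_high_sizes_of_frameOK hR hK₀
  obtain ⟨hA₃', hA₄'⟩ := frameShift_high_sizes_of_frameOK hR hK
  -- the increment
  have hH : ∀ q : Fin 2 → ℝ, (fsub 0 p).eval q = (fsub K₀ p).eval q - K₀.eval q := eval_fsub_zero_eq_sub K₀ p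
  have hh : ∀ j ≤ 4, ∀ q : Momentum, ‖iteratedFDeriv ℝ j (frameShift (fsub 0 p)) q‖ ≤ R.Gfr j * uPow j U * (4 : ℝ) ^ (((j : ℤ) - 2) * n) := by
    rw [frameShift_fsub_zero]; exact hp
  obtain ⟨s0, s1, s2, s3, s4, hl2, hA₃2, hA₄2⟩ :=
    graded₂_hyps_of_increment (K := K₀) (K' := fsub K₀ p) hH hl hA₃l hA₄l hh hh0 hhη
  refine ⟨?_, ?_, ?_, ?_, ?_⟩
  · exact abs_comp_sub_le_graded₂_zero hA hA' hA20 hd hlo hhi hη hη₀ hl2 hA₃ hA₃' hA₃2 hA₄ hA₄' hA₄2 s0 s1 s2 s3 s4 hF hM₁ θ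
  · exact abs_iteratedDeriv_comp_sub_le_graded₂_one hA hA' hA20 hd hlo hhi hη hη₀ hl2 hA₃ hA₃' hA₃2 hA₄ hA₄' hA₄2 s0 s1 s2 s3 s4 hF hM₁ hM₂ θ
  · exact abs_iteratedDeriv_comp_sub_le_graded₂_two hA hA' hA20 hd hlo hhi hη hη₀ hl2 hA₃ hA₃' hA₃2 hA₄ hA₄' hA₄2 s0 s1 s2 s3 s4 hF hM₁
      hM₂ hM₃ θ
  · exact abs_iteratedDeriv_comp_sub_le_graded₂_three hA hA' hA20 hd hlo hhi hη hη₀ hl2 hA₃ hA₃' hA₃2 hA₄ hA₄' hA₄2 s0 s1 s2 s3 s4 hF hM₁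
      hM₂ hM₃ hM₄ θ
  · exact abs_iteratedDeriv_comp_sub_le_graded₂_four hA hA' hA20 hd hlo hhi hη hη₀ hl2 hA₃ hA₃' hA₃2 hA₄ hA₄' hA₄2 s0 s1 s2 s3 s4 hF hM₁
      hM₂ hM₃ hM₄ hM₅ θ


/-- **The (C2) door in FUNCTION form** (same hypotheses): `θ ↦ F(k_F^{K₀⊖p}θ) − F(k_F^{K₀}θ)` is `C⁴` and its `iteratedDeriv k`, `k ≤ 4`, obey the
bounds of `transport_jets_of_frameOK` (value at `k = 0`). -/
theorem transport_jets_of_frameOK_fun :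
    ContDiff ℝ 4 (fun θ : ℝ => F (WithLp.toLp 2 (klFermiPoint μ (fsub K₀ p) θ)) - F (WithLp.toLp 2 (klFermiPoint μ K₀ θ))) ∧
    ∀ θ : ℝ,
      |iteratedDeriv 0 (fun θ : ℝ => F (WithLp.toLp 2 (klFermiPoint μ (fsub K₀ p) θ)) - F (WithLp.toLp 2 (klFermiPoint μ K₀ θ))) θ| ≤
          12.2 * M₁ * η₀ ∧
      |iteratedDeriv 1 (fun θ : ℝ => F (WithLp.toLp 2 (klFermiPoint μ (fsub K₀ p) θ)) - F (WithLp.toLp 2 (klFermiPoint μ K₀ θ))) θ| ≤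
          η * (1420 * M₁ * (2 * l)) + η₀ * (36400 * M₁ + 2820 * M₂) ∧
      |iteratedDeriv 2 (fun θ : ℝ => F (WithLp.toLp 2 (klFermiPoint μ (fsub K₀ p) θ)) - F (WithLp.toLp 2 (klFermiPoint μ K₀ θ))) θ| ≤
          η * (12900000 * M₁ * (2 * l) ^ 2 + 657000 * M₂ * (2 * l)) + η₀ * (338000000 * M₁ * (2 * l) + 25400000 * M₂ + 652000 * M₃) ∧
      |iteratedDeriv 3 (fun θ : ℝ => F (WithLp.toLp 2 (klFermiPoint μ (fsub K₀ p) θ)) - F (WithLp.toLp 2 (klFermiPoint μ K₀ θ))) θ| ≤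
          η * (199000000000 * M₁ * (2 * l) ^ 3 + 12000000000 * M₂ * (2 * l) ^ 2 + 228000000 * M₃ * (2 * l)) +
            η₀ * (5230000000000 * M₁ * (2 * l) ^ 2 + 392000000000 * M₂ * (2 * l) + 11800000000 * M₃ + 151000000 * M₄) ∧
      |iteratedDeriv 4 (fun θ : ℝ => F (WithLp.toLp 2 (klFermiPoint μ (fsub K₀ p) θ)) - F (WithLp.toLp 2 (klFermiPoint μ K₀ θ))) θ| ≤
          η * (4300000000000000 * M₁ * (2 * l) ^ 4 + 276000000000000 * M₂ * (2 * l) ^ 3 + 6890000000000 * M₃ * (2 * l) ^ 2 +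
              70100000000 * M₄ * (2 * l)) +
            η₀ * (114000000000000000 * M₁ * (2 * l) ^ 2 + 8490000000000000 * M₂ * (2 * l) ^ 2 + 272000000000000 * M₃ * (2 * l) +
              4530000000000 * M₄ + 34800000000 * M₅) + 69200000000 * M₁ * (R.Gfr 4 * U ^ 2 * ((16 : ℝ) ^ (n + 1) / 15)) := by
  obtain ⟨hA, hA20, -, hd, ⟨hlo, hhi⟩, -, -⟩ := frame_sizes_of_frameOK_explicit hR hc hcle hU hUle hβmin hβc hμ (FrameOK.mono hR hn hK₀)
  obtain ⟨hA', -, -, -, -, -, -⟩ := frame_sizes_of_frameOK_explicit hR hc hcle hU hUle hβmin hβc hμ (FrameOK.mono hR hn hK)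
  obtain ⟨hA₃, hA₄⟩ := frameShift_high_sizes_of_frameOK hR hK₀
  obtain ⟨hA₃', hA₄'⟩ := frameShift_high_sizes_of_frameOK hR hK
  have hH : ∀ q : Fin 2 → ℝ, (fsub 0 p).eval q = (fsub K₀ p).eval q - K₀.eval q := eval_fsub_zero_eq_sub K₀ p
  have hh : ∀ j ≤ 4, ∀ q : Momentum, ‖iteratedFDeriv ℝ j (frameShift (fsub 0 p)) q‖ ≤ R.Gfr j * uPow j U * (4 : ℝ) ^ (((j : ℤ) - 2) * n) := by
    rw [frameShift_fsub_zero]; exact hp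
  obtain ⟨s0, s1, s2, s3, s4, hl2, hA₃2, hA₄2⟩ :=
    graded₂_hyps_of_increment (K := K₀) (K' := fsub K₀ p) hH hl hA₃l hA₄l hh hh0 hhη
  -- the two curves are `C⁴`
  obtain ⟨hγ, hγ', -⟩ := comp_graded₂_data hA hA' hA20 hd hlo hhi hη hη₀ hl2 hA₃ hA₃' hA₃2 hA₄ hA₄' hA₄2 s0 s1 s2 s3 s4 (0 : ℝ)
  have hF4 : ContDiff ℝ 4 F := hF.of_le (by norm_num)
  have hc' : ContDiff ℝ 4 (F ∘ fun θ : ℝ => (WithLp.toLp 2 (klFermiPoint μ (fsub K₀ p) θ) : Momentum)) := hF4.comp hγ'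
  have hc0 : ContDiff ℝ 4 (F ∘ fun θ : ℝ => (WithLp.toLp 2 (klFermiPoint μ K₀ θ) : Momentum)) := hF4.comp hγ
  have hfun : (fun θ : ℝ => F (WithLp.toLp 2 (klFermiPoint μ (fsub K₀ p) θ)) - F (WithLp.toLp 2 (klFermiPoint μ K₀ θ))) =
      (F ∘ fun θ : ℝ => (WithLp.toLp 2 (klFermiPoint μ (fsub K₀ p) θ) : Momentum)) -
        (F ∘ fun θ : ℝ => (WithLp.toLp 2 (klFermiPoint μ K₀ θ) : Momentum)) := rfl
  refine ⟨by rw [hfun]; exact hc'.sub hc0, fun θ => ?_⟩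
  obtain ⟨b0, b1, b2, b3, b4⟩ := transport_jets_of_frameOK hR hc hcle hU hUle hβmin hβc hμ hn hK₀ hK hp hη hη₀ hl hA₃l hA₄l hh0 hhη hF
    hM₁ hM₂ hM₃ hM₄ hM₅ θ
  have hsub : ∀ k : ℕ, (k : WithTop ℕ∞) ≤ 4 →
      iteratedDeriv k (fun θ : ℝ => F (WithLp.toLp 2 (klFermiPoint μ (fsub K₀ p) θ)) - F (WithLp.toLp 2 (klFermiPoint μ K₀ θ))) θ =
        iteratedDeriv k (F ∘ fun θ : ℝ => (WithLp.toLp 2 (klFermiPoint μ (fsub K₀ p) θ) : Momentum)) θ -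
          iteratedDeriv k (F ∘ fun θ : ℝ => (WithLp.toLp 2 (klFermiPoint μ K₀ θ) : Momentum)) θ := by
    intro k hk
    rw [hfun, iteratedDeriv_sub (hc'.contDiffAt.of_le hk) (hc0.contDiffAt.of_le hk)]
  refine ⟨?_, ?_, ?_, ?_, ?_⟩
  · rw [iteratedDeriv_zero]; exact b0
  · rw [hsub 1 (by norm_num)]; exact b1
  · rw [hsub 2 (by norm_num)]; exact b2
  · rw [hsub 3 (by norm_num)]; exact b3
  · rw [hsub 4 (by norm_num)]; exact b4

end Pair

/-! ## §3 The canonical graded parameters of the flow currency -/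

/-- `4^{(j−2)n} = (4ⁿ)ʲ·(16ⁿ)⁻¹` as real powers. -/
theorem four_zpow_sub_two_mul (j n : ℕ) : (4 : ℝ) ^ (((j : ℤ) - 2) * n) = ((4 : ℝ) ^ n) ^ j * (((4 : ℝ) ^ (2 * n))⁻¹) := by
  have h4 : (4 : ℝ) ≠ 0 := by norm_num
  rw [show ((j : ℤ) - 2) * n = (n * j : ℕ) - (2 * n : ℕ) by push_cast; ring, zpow_sub₀ h4, zpow_natCast, zpow_natCast, pow_mul,
    div_eq_mul_inv]

/-- **Canonical graded parameters**: `η₀ := Gfr₀|U|16^{−n}`, `η := (Gfr₁+Gfr₂+Gfr₃+Gfr₄)U²16^{−n}`, `l := 4ⁿ·(1 + 2(Gfr₃+Gfr₄)U²)` satisfy the four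
side conditions of `transport_jets_of_frameOK`. -/
theorem flow_graded_params {R : RenConsts} (hR : ∀ j, 0 ≤ R.Gfr j) (U : ℝ) (n : ℕ) :
    1 ≤ (4 : ℝ) ^ n * (1 + 2 * (R.Gfr 3 + R.Gfr 4) * U ^ 2) ∧
    R.Gfr 3 * U ^ 2 * ((4 : ℝ) ^ (n + 1) / 3) ≤ (4 : ℝ) ^ n * (1 + 2 * (R.Gfr 3 + R.Gfr 4) * U ^ 2) ∧
    R.Gfr 4 * U ^ 2 * ((16 : ℝ) ^ (n + 1) / 15) ≤ ((4 : ℝ) ^ n * (1 + 2 * (R.Gfr 3 + R.Gfr 4) * U ^ 2)) ^ 2 ∧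
    R.Gfr 0 * uPow 0 U * (4 : ℝ) ^ ((((0 : ℕ) : ℤ) - 2) * n) ≤ R.Gfr 0 * |U| * ((4 : ℝ) ^ (2 * n))⁻¹ ∧
    (∀ j : ℕ, 1 ≤ j → j ≤ 4 → R.Gfr j * uPow j U * (4 : ℝ) ^ (((j : ℤ) - 2) * n) ≤
      (R.Gfr 1 + R.Gfr 2 + R.Gfr 3 + R.Gfr 4) * U ^ 2 * ((4 : ℝ) ^ (2 * n))⁻¹ * ((4 : ℝ) ^ n * (1 + 2 * (R.Gfr 3 + R.Gfr 4) * U ^ 2)) ^ j) := by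
  have h3 := hR 3; have h4 := hR 4; have h1 := hR 1; have h2 := hR 2; have h0 := hR 0
  have hU2 : 0 ≤ U ^ 2 := sq_nonneg U
  have h4n : 1 ≤ (4 : ℝ) ^ n := one_le_pow₀ (by norm_num)
  have hΛ : 1 ≤ 1 + 2 * (R.Gfr 3 + R.Gfr 4) * U ^ 2 := by nlinarith
  have hl : 1 ≤ (4 : ℝ) ^ n * (1 + 2 * (R.Gfr 3 + R.Gfr 4) * U ^ 2) := one_le_mul_of_one_le_of_one_le h4n hΛ
  refine ⟨hl, ?_, ?_, ?_, ?_⟩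
  · have e4 : (4 : ℝ) ^ (n + 1) = 4 ^ n * 4 := pow_succ 4 n
    rw [e4]
    nlinarith [mul_nonneg (mul_nonneg h3 hU2) (zero_le_one.trans h4n), mul_nonneg (mul_nonneg h4 hU2) (zero_le_one.trans h4n)]
  · have e16 : (16 : ℝ) ^ (n + 1) = ((4 : ℝ) ^ n) ^ 2 * 16 := by
      rw [pow_succ, show (16 : ℝ) = 4 ^ 2 by norm_num, ← pow_mul, ← pow_mul, mul_comm 2 n]
    rw [e16]
    have hΛ2 : 1 + 2 * (R.Gfr 3 + R.Gfr 4) * U ^ 2 ≤ (1 + 2 * (R.Gfr 3 + R.Gfr 4) * U ^ 2) ^ 2 := by nlinarith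
    have hsq : 0 ≤ ((4 : ℝ) ^ n) ^ 2 := sq_nonneg _
    nlinarith [mul_nonneg (mul_nonneg h4 hU2) hsq, mul_nonneg (mul_nonneg h3 hU2) hsq, mul_le_mul_of_nonneg_left hΛ2 hsq]
  · simp only [uPow, if_true, Nat.cast_zero, zero_sub]
    rw [show (-2 : ℤ) * n = -((2 * n : ℕ) : ℤ) by push_cast; ring, zpow_neg, zpow_natCast]
  · intro j hj1 hj4
    have hj0 : j ≠ 0 := by omega
    simp only [uPow, hj0, if_false]
    rw [four_zpow_sub_two_mul, mul_pow]
    have hGj : R.Gfr j ≤ R.Gfr 1 + R.Gfr 2 + R.Gfr 3 + R.Gfr 4 := by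
      interval_cases j <;> linarith
    have hΛj : 1 ≤ (1 + 2 * (R.Gfr 3 + R.Gfr 4) * U ^ 2) ^ j := one_le_pow₀ hΛ
    have hP : 0 ≤ ((4 : ℝ) ^ n) ^ j * ((4 : ℝ) ^ (2 * n))⁻¹ := by positivity
    have hGj0 : 0 ≤ R.Gfr j := hR j
    calc R.Gfr j * U ^ 2 * (((4 : ℝ) ^ n) ^ j * ((4 : ℝ) ^ (2 * n))⁻¹)
        = (R.Gfr j * U ^ 2) * (((4 : ℝ) ^ n) ^ j * ((4 : ℝ) ^ (2 * n))⁻¹) * 1 := by ring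
      _ ≤ ((R.Gfr 1 + R.Gfr 2 + R.Gfr 3 + R.Gfr 4) * U ^ 2) * (((4 : ℝ) ^ n) ^ j * ((4 : ℝ) ^ (2 * n))⁻¹) *
            (1 + 2 * (R.Gfr 3 + R.Gfr 4) * U ^ 2) ^ j := by
          apply mul_le_mul (mul_le_mul_of_nonneg_right (mul_le_mul_of_nonneg_right hGj hU2) hP) hΛj zero_le_one
          exact mul_nonneg (mul_nonneg (by linarith) hU2) hP
      _ = (R.Gfr 1 + R.Gfr 2 + R.Gfr 3 + R.Gfr 4) * U ^ 2 * ((4 : ℝ) ^ (2 * n))⁻¹ *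
            (((4 : ℝ) ^ n) ^ j * (1 + 2 * (R.Gfr 3 + R.Gfr 4) * U ^ 2) ^ j) := by ring


/-! ## §4 The flow pair `K_n`, `K_{n+1} = K_n ⊖ klFlowPiece n`, symbol `ν̃_n = symInterp L (klLocSelfEnergyRe … K_n n)` -/

section Flow

variable {L M : ℕ} [NeZero L] [NeZero M]
  {R : RenConsts} (hR : ∀ j, 0 ≤ R.Gfr j) {c U β μ : ℝ} (hc : 0 < c) (hcle : c ≤ klCurveC3 R) (hU : 0 < U) (hUle : U ≤ klCurveU0 R)
  (hβmin : klBetaMin ≤ β) (hβc : β ≤ Real.exp (c / U ^ 2)) (hμ : μ ∈ klWindowC) {n : ℕ} (hn : n ≤ nScales β)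
  (hK₀ : FrameOK R U n μ (klFlowFrameU L M β U μ n)) (hK : FrameOK R U n μ (klFlowFrameU L M β U μ (n + 1)))
  (hp : FlowPieceJetsAt L M β U μ R n)
  {η η₀ l : ℝ} (hη : 0 ≤ η) (hη₀ : 0 ≤ η₀) (hl : 1 ≤ l)
  (hA₃l : R.Gfr 3 * U ^ 2 * ((4 : ℝ) ^ (n + 1) / 3) ≤ l) (hA₄l : R.Gfr 4 * U ^ 2 * ((16 : ℝ) ^ (n + 1) / 15) ≤ l ^ 2)
  (hh0 : R.Gfr 0 * uPow 0 U * (4 : ℝ) ^ ((((0 : ℕ) : ℤ) - 2) * n) ≤ η₀)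
  (hhη : ∀ j : ℕ, 1 ≤ j → j ≤ 4 → R.Gfr j * uPow j U * (4 : ℝ) ^ (((j : ℤ) - 2) * n) ≤ η * l ^ j)
  (hF : ContDiff ℝ 5 fun q : Momentum =>
    (symInterp L (klLocSelfEnergyRe L M β U μ (klFlowFrameU L M β U μ n) n)).eval (WithLp.ofLp q))
  {M₁ M₂ M₃ M₄ M₅ : ℝ}
  (hM₁ : ∀ z, ‖fderiv ℝ (fun q : Momentum =>
    (symInterp L (klLocSelfEnergyRe L M β U μ (klFlowFrameU L M β U μ n) n)).eval (WithLp.ofLp q)) z‖ ≤ M₁)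
  (hM₂ : ∀ z, ‖fderiv ℝ (fderiv ℝ (fun q : Momentum =>
    (symInterp L (klLocSelfEnergyRe L M β U μ (klFlowFrameU L M β U μ n) n)).eval (WithLp.ofLp q))) z‖ ≤ M₂)
  (hM₃ : ∀ z, ‖fderiv ℝ (fderiv ℝ (fderiv ℝ (fun q : Momentum =>
    (symInterp L (klLocSelfEnergyRe L M β U μ (klFlowFrameU L M β U μ n) n)).eval (WithLp.ofLp q)))) z‖ ≤ M₃)
  (hM₄ : ∀ z, ‖fderiv ℝ (fderiv ℝ (fderiv ℝ (fderiv ℝ (fun q : Momentum =>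
    (symInterp L (klLocSelfEnergyRe L M β U μ (klFlowFrameU L M β U μ n) n)).eval (WithLp.ofLp q))))) z‖ ≤ M₄)
  (hM₅ : ∀ z, ‖fderiv ℝ (fderiv ℝ (fderiv ℝ (fderiv ℝ (fderiv ℝ (fun q : Momentum =>
    (symInterp L (klLocSelfEnergyRe L M β U μ (klFlowFrameU L M β U μ n) n)).eval (WithLp.ofLp q)))))) z‖ ≤ M₅)
include hR hc hcle hU hUle hβmin hβc hμ hn hK₀ hK hp hη hη₀ hl hA₃l hA₄l hh0 hhη hF hM₁ hM₂ hM₃ hM₄ hM₅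

/-- **THE (C2) DOOR FOR THE FLOW** — the `hTdiff`/`hT`-shaped input of `readResidue_flow_hP`: the transport term
`θ ↦ ν̃_n(k_F^{K_{n+1}}θ) − ν_n(K_n)(θ)` is `C⁴` with the explicit graded bounds on `iteratedDeriv k`, `k ≤ 4`. -/
theorem transport_jets_flow :
    ContDiff ℝ 4 (fun θ : ℝ =>
      (symInterp L (klLocSelfEnergyRe L M β U μ (klFlowFrameU L M β U μ n) n)).eval (klFermiPoint μ (klFlowFrameU L M β U μ (n + 1)) θ) -
        klLocalPart L M β U μ (klFlowFrameU L M β U μ n) n θ) ∧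
    ∀ θ : ℝ,
      |iteratedDeriv 0 (fun θ : ℝ =>
          (symInterp L (klLocSelfEnergyRe L M β U μ (klFlowFrameU L M β U μ n) n)).eval (klFermiPoint μ (klFlowFrameU L M β U μ (n + 1)) θ) -
            klLocalPart L M β U μ (klFlowFrameU L M β U μ n) n θ) θ| ≤ 12.2 * M₁ * η₀ ∧
      |iteratedDeriv 1 (fun θ : ℝ =>
          (symInterp L (klLocSelfEnergyRe L M β U μ (klFlowFrameU L M β U μ n) n)).eval (klFermiPoint μ (klFlowFrameU L M β U μ (n + 1)) θ) -
            klLocalPart L M β U μ (klFlowFrameU L M β U μ n) n θ) θ| ≤ η * (1420 * M₁ * (2 * l)) + η₀ * (36400 * M₁ + 2820 * M₂) ∧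
      |iteratedDeriv 2 (fun θ : ℝ =>
          (symInterp L (klLocSelfEnergyRe L M β U μ (klFlowFrameU L M β U μ n) n)).eval (klFermiPoint μ (klFlowFrameU L M β U μ (n + 1)) θ) -
            klLocalPart L M β U μ (klFlowFrameU L M β U μ n) n θ) θ| ≤
          η * (12900000 * M₁ * (2 * l) ^ 2 + 657000 * M₂ * (2 * l)) + η₀ * (338000000 * M₁ * (2 * l) + 25400000 * M₂ + 652000 * M₃) ∧
      |iteratedDeriv 3 (fun θ : ℝ =>
          (symInterp L (klLocSelfEnergyRe L M β U μ (klFlowFrameU L M β U μ n) n)).eval (klFermiPoint μ (klFlowFrameU L M β U μ (n + 1)) θ) -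
            klLocalPart L M β U μ (klFlowFrameU L M β U μ n) n θ) θ| ≤
          η * (199000000000 * M₁ * (2 * l) ^ 3 + 12000000000 * M₂ * (2 * l) ^ 2 + 228000000 * M₃ * (2 * l)) +
            η₀ * (5230000000000 * M₁ * (2 * l) ^ 2 + 392000000000 * M₂ * (2 * l) + 11800000000 * M₃ + 151000000 * M₄) ∧
      |iteratedDeriv 4 (fun θ : ℝ =>
          (symInterp L (klLocSelfEnergyRe L M β U μ (klFlowFrameU L M β U μ n) n)).eval (klFermiPoint μ (klFlowFrameU L M β U μ (n + 1)) θ) -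
            klLocalPart L M β U μ (klFlowFrameU L M β U μ n) n θ) θ| ≤
          η * (4300000000000000 * M₁ * (2 * l) ^ 4 + 276000000000000 * M₂ * (2 * l) ^ 3 + 6890000000000 * M₃ * (2 * l) ^ 2 +
              70100000000 * M₄ * (2 * l)) +
            η₀ * (114000000000000000 * M₁ * (2 * l) ^ 2 + 8490000000000000 * M₂ * (2 * l) ^ 2 + 272000000000000 * M₃ * (2 * l) +
              4530000000000 * M₄ + 34800000000 * M₅) + 69200000000 * M₁ * (R.Gfr 4 * U ^ 2 * ((16 : ℝ) ^ (n + 1) / 15)) := by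
  have hfun : (fun θ : ℝ =>
      (symInterp L (klLocSelfEnergyRe L M β U μ (klFlowFrameU L M β U μ n) n)).eval (klFermiPoint μ (klFlowFrameU L M β U μ (n + 1)) θ) -
        klLocalPart L M β U μ (klFlowFrameU L M β U μ n) n θ) =
      fun θ : ℝ =>
        (fun q : Momentum => (symInterp L (klLocSelfEnergyRe L M β U μ (klFlowFrameU L M β U μ n) n)).eval (WithLp.ofLp q))
            (WithLp.toLp 2 (klFermiPoint μ (fsub (klFlowFrameU L M β U μ n) (klFlowPiece L M β U μ n)) θ)) -
          (fun q : Momentum => (symInterp L (klLocSelfEnergyRe L M β U μ (klFlowFrameU L M β U μ n) n)).eval (WithLp.ofLp q))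
            (WithLp.toLp 2 (klFermiPoint μ (klFlowFrameU L M β U μ n) θ)) := by
    funext θ
    simp only [klLocalPart, klFlowFrameU_succ]
  rw [hfun]
  rw [klFlowFrameU_succ] at hK
  exact transport_jets_of_frameOK_fun hR hc hcle hU hUle hβmin hβc hμ hn hK₀ hK hp hη hη₀ hl hA₃l hA₄l hh0 hhη hF hM₁ hM₂ hM₃ hM₄ hM₅

end Flow

end Summit.HubbardSuperconductivity.HubbardSuperconductivity.Theorems.PerturbedFermiCurve

end
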